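import Summits.NavierStokesRegularity.NavierStokesRegularity.Theorems.TautLoopKelvinTautCompressionIntegrableSummitEquivalenceLawOnly
import Summits.NavierStokesRegularity.NavierStokesRegularity.Theorems.TautLoopKelvinTautLoopLaw
import Summits.NavierStokesRegularity.NavierStokesRegularity.Theorems.TautCompressionIntegrable.Negative.FalseWithoutMomentumEnergyClass
import HarnessLib

/-!
# Strategy census (typed companion) — crux `TautLoopKelvin.TautCompressionIntegrable` (K1, stmt-NavierStokesRegularity-15248)

Typed companions of `STRATEGY-CENSUS.md` (crux-strategist seat
`planner-cstrat-stmt-NavierStokesRegularity-15248-0`, 2026-08-17). Nothing here is a line or a stub: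
the file (i) re-derives the UNCONDITIONAL certificate `K1 ↔ NavierStokesRegularity` from landed
theorems (TautLoopLaw proved 18:34Z + the c2 Law-only certificate), (ii) TYPES the best decomposition
(D1: `K1 ↔ NoTypeIBlowup ∧ NoTypeII`, both directions proved here from landed theorems) and the
strengthenings S⁺1–S⁺3 discussed in the census, and proves the bookkeeping implications, so that
the census statements are checked signatures rather than prose. Sorry-free; axioms standard.
-/

noncomputable section

set_option linter.dupNamespace false

namespace Summit.NavierStokesRegularity.NavierStokesRegularity.Cruxes.TautCompressionIntegrable.StrategyCensus

open MeasureTheory Set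
open scoped ENNReal
open Literature.Analysis.FluidPDE
open Summit.NavierStokesRegularity.NavierStokesRegularity
open Summit.NavierStokesRegularity.NavierStokesRegularity.Theorems.TautCompressionIntegrable

local notation "ℝ³" => EuclideanSpace ℝ (Fin 3)

/-- Shorthand for the crux. -/
abbrev K1 : Prop := Theses.TautLoopKelvin.TautCompressionIntegrable

/-! ## §0 Certificate: the crux IS the summit (no hypothesis left) -/

/-- **K1 ↔ Clay (A)**, unconditionally: the Law-only certificate (p163735) fed with the landed
`tautLoopKelvin_tautLoopLaw_proof` (stmt-15249, 2026-08-17T18:34Z). [folklore] -/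
theorem K1_iff_summit : K1 ↔ _root_.NavierStokesRegularity :=
  SummitEquivalence.tautCompressionIntegrable_iff_navierStokesRegularity_of_tautLoopLaw
    Theorems.tautLoopKelvin_tautLoopLaw_proof

/-- **K1 ↔ stmt-0054** (no blow-up in the Clay class), unconditionally. [folklore] -/
theorem K1_iff_noBlowup : K1 ↔ Theses.TypeILiouville.TypeIliouvilleThesis :=
  SummitEquivalence.tautCompressionIntegrable_iff_typeILiouvilleThesis_of_tautLoopLaw
    Theorems.tautLoopKelvin_tautLoopLaw_proof

/-- Negation side: a counterexample to K1 is exactly a counterexample to Clay (A). [folklore] -/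
theorem not_K1_iff_not_summit : ¬ K1 ↔ ¬ _root_.NavierStokesRegularity :=
  not_congr K1_iff_summit

/-! ## §Decomposition D1 — the best typed split: `K1 ↔ NoTypeIBlowup ∧ NoTypeII` (pieces = stmt-1217, stmt-0056) -/

/-- The two rate pieces give K1 (LANDED, p161804 — the birth line's composition). [folklore] -/
theorem K1_of_rateSplit (hI : Theses.TypeICertificateLadder.NoTypeIBlowup)
    (hII : Theses.TypeICertificateLadder.NoTypeII) : K1 :=
  SummitEquivalence.tautCompressionIntegrable_of_noTypeIBlowup_of_noTypeII hI hII

/-- Conversely K1 gives both pieces (through stmt-0054): the split is an EQUIVALENCE, i.e. it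
re-partitions the summit rather than weakening it. [folklore] -/
theorem rateSplit_of_K1 (hK1 : K1) :
    Theses.TypeICertificateLadder.NoTypeIBlowup ∧ Theses.TypeICertificateLadder.NoTypeII := by
  have hNB : Theses.TypeILiouville.TypeIliouvilleThesis := K1_iff_noBlowup.1 hK1
  refine ⟨?_, ?_⟩
  · intro ν T hν hT u p hcl hLH hdec _hTypeI
    exact hNB ν T hν hT u p hcl hLH hdec
  · intro ν T hν hT u p hmax hLH hdec
    exact absurd (hNB ν T hν hT u p hmax.1 hLH hdec) hmax.2

/-- D1 as an `iff`. [folklore] -/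
theorem K1_iff_rateSplit :
    K1 ↔ (Theses.TypeICertificateLadder.NoTypeIBlowup ∧ Theses.TypeICertificateLadder.NoTypeII) :=
  ⟨rateSplit_of_K1, fun h => K1_of_rateSplit h.1 h.2⟩

/-! ## §Strengthen — typed S⁺ candidates (signatures only; status in the docstrings) -/

/-- **S⁺1 (quantitative K1).** The majorant's mass `M` is bounded by a universal function of
`(ν, T, A)` where `A` bounds the energy and the gradient of the datum. Relation to S: S⁺1 ⇒ K1 ⇔ S
trivially (below); S ⇒ S⁺1 is Tao's concentration-compactness equivalence of qualitative and
quantitative regularity (arXiv:1108.1165 Thm 1.20(vi), H¹(ℝ³) category) composed with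
`Λ_g ≤ ‖∇u‖_∞` — it consumes no structure of K1 and supplies no induction parameter. NOT FILED. -/
def QuantitativeTautCompression : Prop :=
  ∃ F : ℝ → ℝ → ℝ → ℝ, ∀ (ν T : ℝ), 0 < ν → 0 < T →
    ∀ (u : ℝ → ℝ³ → ℝ³) (p : ℝ → ℝ³ → ℝ),
    IsClassicalNSSolutionOn (Set.Ico 0 T) ν 0 u p → IsLerayHopfOn T ν 0 (u 0) u →
    HasRapidSpatialDecay (u 0) →
    ∀ A : ℝ, (∫ x, ‖u 0 x‖ ^ 2) ≤ A → (∀ x, ‖fderiv ℝ (u 0) x‖ ≤ A) →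
    ∀ g : ℝ, 0 < g → ∃ (Φ : ℝ → ℝ) (M : ℝ), Measurable Φ ∧ 0 ≤ M ∧ M ≤ F ν T A ∧
      (∀ s ∈ Set.Ioo 0 T, Negative.nearTautRate (u s) g ≤ Φ s) ∧
      (∫⁻ s in Set.Ioo 0 T, ENNReal.ofReal (Φ s)) ≤ ENNReal.ofReal M

/-- S⁺1 ⇒ K1 (drop the bound; `Negative.nearTautRate` unfolds verbatim to the crux's functional).
[folklore] -/
theorem K1_of_quantitative (h : QuantitativeTautCompression) : K1 := by
  obtain ⟨F, hF⟩ := h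
  intro ν T hν hT u p hcl hLH hdec g hg
  -- any admissible `A`: the datum is rapidly decaying, so both quantities are finite; we only need
  -- SOME real `A` dominating them, and the conclusion does not mention `A`.
  obtain ⟨C₁, hC₁⟩ := hdec 1 0
  set A : ℝ := max (∫ x, ‖u 0 x‖ ^ 2) C₁ with hA
  have h1 : (∫ x, ‖u 0 x‖ ^ 2) ≤ A := le_max_left _ _
  have h2 : ∀ x, ‖fderiv ℝ (u 0) x‖ ≤ A := by
    intro x
    -- `hdec 1 0 : ∃ C, ∀ x, (1 + ‖x‖) ^ 0 * ‖iteratedFDeriv ℝ 1 (u 0) x‖ ≤ C`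
    have : ‖fderiv ℝ (u 0) x‖ ≤ C₁ := by simpa using hC₁ x
    exact this.trans (le_max_right _ _)
  obtain ⟨Φ, M, hΦ, hM, -, hmaj, hint⟩ := hF ν T hν hT u p hcl hLH hdec A h1 h2 g hg
  exact ⟨Φ, M, hΦ, hM, hmaj, hint⟩

/-- **S⁺2 (Lipschitz circulation–length spectrum).** `ℓ(g,t)²` can decrease at most at the rate
`C·ν`: a Λ-free, scale-invariant strengthening that would give K1's consequence
`QuantumCircleNonCollapse` directly. FALSE already at regular times: under transport a quantum loop
of length `ℓ` in a strain of rate `a` has `d(ℓ²)/dt = −a ℓ²`, unbounded in units of `ν` for a fat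
weak tube in strong strain (exact model: the unsteady Burgers vortex, Majda–Bertozzi (2002)
Ex. 2.9–2.10, core `δ(t)² = δ₀² e^{−at} + (4ν/a)(1 − e^{−at})`, `ℓ(g,t)² = 4π² δ(t)² g/Γ`).
NOT FILED (would be refuted on an explicit smooth flow). -/
def LipschitzSpectrum : Prop :=
  ∃ C : ℝ, 0 ≤ C ∧ ∀ (ν T : ℝ), 0 < ν → 0 < T →
    ∀ (u : ℝ → ℝ³ → ℝ³) (p : ℝ → ℝ³ → ℝ),
    IsClassicalNSSolutionOn (Set.Ico 0 T) ν 0 u p → IsLerayHopfOn T ν 0 (u 0) u →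
    HasRapidSpatialDecay (u 0) →
    ∀ g : ℝ, 0 < g → ∀ t₁ t₂ : ℝ, 0 ≤ t₁ → t₁ ≤ t₂ → t₂ < T →
      Negative.ell (u t₁) g ^ 2 ≤ Negative.ell (u t₂) g ^ 2 + ENNReal.ofReal (C * ν * (t₂ - t₁))

/-- **S⁺3 (all-levels closure).** The quantum compression rate is controlled by the coarser part of
the spectrum itself: `Λ_g(s) ≤ C · sup_{g' ≥ g} g'/ℓ(g',s)²` (Biot–Savart heuristics: a structure of
circulation `g'` and size `ℓ(g')` induces strain `≲ g'/ℓ(g')²`). Even if TRUE it gives no leverage: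
by the flux/isoperimetric bound `ℓ(g')² ≥ 4π g'/‖ω(s)‖_∞` the right side is `≍ ‖ω(s)‖_∞` in the
intense-tube (Lundgren) scenario, so closing the Law with it is `∫‖ω‖_∞ < ∞` = Beale–Kato–Majda.
NOT FILED. -/
def LevelClosure : Prop :=
  ∃ C : ℝ, 0 ≤ C ∧ ∀ (ν T : ℝ), 0 < ν → 0 < T →
    ∀ (u : ℝ → ℝ³ → ℝ³) (p : ℝ → ℝ³ → ℝ),
    IsClassicalNSSolutionOn (Set.Ico 0 T) ν 0 u p → IsLerayHopfOn T ν 0 (u 0) u →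
    HasRapidSpatialDecay (u 0) →
    ∀ s ∈ Set.Ioo 0 T, ∀ g : ℝ, 0 < g →
      Negative.nearTautRate (u s) g ≤
        C * sSup {x : ℝ | ∃ g' : ℝ, g ≤ g' ∧ x = g' / (Negative.ell (u s) g').toReal ^ 2}

/-! ## §Negation — what any counterexample must be, and what the Disproof already certifies -/

/-- The momentum equation is load-bearing (disprover, p161007): dropping it, K1's conclusion fails in
the energy class on an explicit Leray-scaled swirl–strain field. Cited by name. -/
example := @Negative.tautCompressionIntegrable_false_without_momentum_energyClass

/-- A counterexample to K1 is a finite-time singularity from a rapidly decaying datum (and conversely):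
`¬K1 ↔ ¬Clay (A)`; so every Negation attempt is an attempt at the Clay blow-up problem itself. -/
example : ¬ K1 ↔ ¬ _root_.NavierStokesRegularity := not_K1_iff_not_summit

end Summit.NavierStokesRegularity.NavierStokesRegularity.Cruxes.TautCompressionIntegrable.StrategyCensus
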